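import Mathlib
import Summits.MatrixMultiplication.MatrixMultiplication.Theorems.LevelGradedCohnUmansLevelOneGL2DesignsTangencyPolarity

/-!
# Baer's theorem in the plane of the stub: polarities of `PG(2,p)` have `p + 1` absolute points —
stub `stub_tangencySets` (crux `LevelOneGL2Designs`, stmt-MatrixMultiplication-14080), wall-breaker
axis 7/12 "Hermitian unital constructions", generation 1, companion to `…TangencyPolarity`

`…TangencyPolarity` proves Baer's theorem for abstract finite projective planes
(`BaerPolarity.card_absolute_eq_of_not_isSquare`).  This file instantiates it on Mathlib's model
`ℙ K (Fin 3 → K)` of the Desarguesian plane `PG(2,K)` (`Configuration.ofField`, incidence =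
orthogonality of representative vectors), the projective closure of the affine plane over `ZMod p`
in which `stub_tangencySets` is stated:

* `order_projectivization` — the order of `PG(2,K)` is `|K|` (from `|ℙ K (Fin 3 → K)| = |K|² + |K| + 1`,
  `Projectivization.card_of_finrank`, and `|P| = n² + n + 1`);
* `card_absolute_eq_card` — over a finite field of NON-SQUARE order (e.g. `ZMod p`), every
  polarity of `PG(2,K)` has exactly `|K| + 1` absolute points, and (`card_polar_flags_le_card`)
  every family of point–polar flags has at most `|K| + 1` members;
* `card_isotropic_points` — the identity map IS a polarity in this model (the standard
  orthogonal one), so Baer's theorem computes, with no algebra at all, the number of points of the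
  conic `x₀² + x₁² + x₂² = 0` in `PG(2,K)`: exactly `|K| + 1` whenever `|K|` is not a square
  (for `|K| = 2` the "conic" is the line `x₀ + x₁ + x₂ = 0`);
* `matrixPolarity_symm`, `polar_srs_card_le` — in the STUB'S OWN FORMAT: an SRS
  `a_f ⬝ᵥ b_{f'} = 1 ↔ f = f'` whose lines are the polars of its points under one orthogonal
  polarity (`(b,−1) ∥ G(a,1)`, `G` symmetric non-degenerate — the unital's recipe with Frobenius
  replaced by the identity, the only option over a prime field) has `≤ |K| + 1` flags;
* `card_absolute_eq_zmod`, `card_isotropic_points_zmod`, `polar_srs_card_le_zmod` — the case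
  `K = ZMod p`, `p` prime: `p + 1`.

Reading for the stub: in its own plane the recipe "points of a unital + their polars" can never
beat the conic; `…TangencyBaerSubplanes` (descent), `…StubTangencySetsHermitianCircles*`,
`…TangencyNormPencil*`, `…TangencyUnipotentSymmetry*` (symmetric substitutes ⇒ Paley cliques) are the
other closed doors of the axis. [cite: Baer1946PolaritiesFiniteProjectivePlanes, Thm 6]
Mathlib + `…TangencyPolarity`; no definitions.
-/

-- `Summit.MatrixMultiplication.MatrixMultiplication.…` is the tree's mandated summit/problem namespace (D-0017).
set_option linter.dupNamespace false

namespace Summit.MatrixMultiplication.MatrixMultiplication.Theorems.LevelOneGL2Designs.BaerPolarity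

open scoped LinearAlgebra.Projectivization
open Finset Matrix Configuration Projectivization

section PG

variable (K : Type*) [Field K] [Fintype K] [DecidableEq K]

/-- **The order of `PG(2,K)` is `|K|`.**  Mathlib's `ℙ K (Fin 3 → K)` with orthogonality as
incidence is a projective plane with `|K|² + |K| + 1` points, hence of order `|K|`. [folklore] -/
theorem order_projectivization :
    ProjectivePlane.order (ℙ K (Fin 3 → K)) (ℙ K (Fin 3 → K)) = Fintype.card K := by
  classical
  haveI : Fintype (ℙ K (Fin 3 → K)) := Fintype.ofFinite _
  set n := ProjectivePlane.order (ℙ K (Fin 3 → K)) (ℙ K (Fin 3 → K)) with hn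
  have h1 : Fintype.card (ℙ K (Fin 3 → K)) = n ^ 2 + n + 1 :=
    ProjectivePlane.card_points (ℙ K (Fin 3 → K)) (ℙ K (Fin 3 → K))
  have h2 : Nat.card (ℙ K (Fin 3 → K)) = ∑ i ∈ Finset.range 3, Nat.card K ^ i :=
    Projectivization.card_of_finrank K (Fin 3 → K) (by simp)
  rw [Nat.card_eq_fintype_card, Nat.card_eq_fintype_card, h1] at h2
  simp only [Finset.sum_range_succ, Finset.sum_range_zero, zero_add, pow_zero, pow_one] at h2
  -- `n² + n + 1 = 1 + q + q²` forces `n = q`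
  set q := Fintype.card K with hq
  rcases lt_trichotomy n q with h | h | h
  · nlinarith
  · exact h
  · nlinarith

/-- **Baer's theorem for `PG(2,K)`, `|K|` non-square.**  Every polarity of the Desarguesian plane
over a finite field of non-square order has exactly `|K| + 1` absolute points.
[cite: Baer1946PolaritiesFiniteProjectivePlanes, Thm 6] -/
theorem card_absolute_eq_card (hK : ¬ IsSquare (Fintype.card K))
    (φ : ℙ K (Fin 3 → K) → ℙ K (Fin 3 → K)) (hφ : ∀ x y, x ∈ φ y ↔ y ∈ φ x) :
    Nat.card {x // x ∈ φ x} = Fintype.card K + 1 := by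
  classical
  haveI : Fintype (ℙ K (Fin 3 → K)) := Fintype.ofFinite _
  rw [← order_projectivization K]
  exact card_absolute_eq_of_not_isSquare φ hφ (by rwa [order_projectivization K])

/-- **Point–polar flags in `PG(2,K)`, `|K|` non-square: at most `|K| + 1`.**
[cite: Baer1946PolaritiesFiniteProjectivePlanes, Thm 6 (corollary)] -/
theorem card_polar_flags_le_card (hK : ¬ IsSquare (Fintype.card K))
    (φ : ℙ K (Fin 3 → K) → ℙ K (Fin 3 → K)) (hφ : ∀ x y, x ∈ φ y ↔ y ∈ φ x)
    (S : Finset (ℙ K (Fin 3 → K) × ℙ K (Fin 3 → K))) (hS : ∀ f ∈ S, f.2 = φ f.1 ∧ f.1 ∈ f.2) :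
    S.card ≤ Fintype.card K + 1 := by
  classical
  haveI : Fintype (ℙ K (Fin 3 → K)) := Fintype.ofFinite _
  rw [← order_projectivization K]
  exact card_polar_flags_le_of_not_isSquare φ hφ (by rwa [order_projectivization K]) S hS

/-- **The conic `x₀² + x₁² + x₂² = 0` has `|K| + 1` points when `|K|` is not a square** — by
Baer's theorem alone: in Mathlib's model incidence is orthogonality, so the identity map is a
polarity (the standard orthogonal one) whose absolute points are the self-orthogonal points.
[elementary consequence of Baer1946PolaritiesFiniteProjectivePlanes, Thm 6] -/
theorem card_isotropic_points (hK : ¬ IsSquare (Fintype.card K)) :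
    Nat.card {x : ℙ K (Fin 3 → K) // x ∈ x} = Fintype.card K + 1 :=
  card_absolute_eq_card K hK id fun x y => by
    simp only [id_eq, Configuration.ofField.mem_iff]
    exact ⟨orthogonal_comm.mp, orthogonal_comm.mp⟩

omit [Fintype K] [DecidableEq K] in
/-- **The polarity of a symmetric matrix.**  For a symmetric matrix `G` with `v ↦ G v` injective,
`[v] ↦ [G v]` has symmetric incidence in Mathlib's model of `PG(2,K)` (incidence =
orthogonality): `u ⬝ G v = v ⬝ G u`.  These are the orthogonal polarities; over a prime field
every polarity of `PG(2,p)` is of this form. [elementary] -/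
theorem matrixPolarity_symm (G : Matrix (Fin 3) (Fin 3) K) (hG : G.IsSymm)
    (hGi : Function.Injective (Matrix.toLin' G)) (x y : ℙ K (Fin 3 → K)) :
    x ∈ Projectivization.map (Matrix.toLin' G) hGi y ↔
      y ∈ Projectivization.map (Matrix.toLin' G) hGi x := by
  have key : ∀ u v : Fin 3 → K, u ⬝ᵥ (G *ᵥ v) = v ⬝ᵥ (G *ᵥ u) := fun u v => by
    rw [Matrix.dotProduct_mulVec, ← Matrix.mulVec_transpose, hG.eq, dotProduct_comm]
  induction x with | h u hu => induction y with | h v hv =>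
  simp only [Projectivization.map_mk, Configuration.ofField.mem_iff, orthogonal_mk,
    Matrix.toLin'_apply]
  rw [key]

/-- **Polar strong representative systems are conics: at most `|K| + 1` flags.**  In the
dot-product normal form of `stub_tangencySets` (flags `(a, b)`: the point `a` and the line
`{x : b ⬝ᵥ x = 1}`, with `a_f ⬝ᵥ b_{f'} = 1 ↔ f = f'`), suppose every line is the POLAR of its
point with respect to one non-degenerate symmetric matrix `G` — in homogeneous coordinates
`(b, −1) ∥ G·(a, 1)` — which is exactly how the Hermitian unital produces its tangents over a
square field (with a unitary instead of an orthogonal polarity).  If `|K|` is not a square (e.g.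
`K = ZMod p`) then `|S| ≤ |K| + 1`: the points are absolute points of the polarity `[v] ↦ [Gv]` of
`PG(2,K)`, and Baer's theorem counts them.  (Directly: they lie on the conic `x̂ᵀ G x̂ = 0`.)
[cite: Baer1946PolaritiesFiniteProjectivePlanes, Thm 6 (consequence)] -/
theorem polar_srs_card_le (hK : ¬ IsSquare (Fintype.card K)) (G : Matrix (Fin 3) (Fin 3) K)
    (hG : G.IsSymm) (hGdet : G.det ≠ 0) (S : Finset ((Fin 2 → K) × (Fin 2 → K)))
    (hS : ∀ f ∈ S, ∀ f' ∈ S, (f.1 ⬝ᵥ f'.2 = 1 ↔ f = f'))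
    (hpolar : ∀ f ∈ S, ∃ t : K, t ≠ 0 ∧
      (![f.2 0, f.2 1, -1] : Fin 3 → K) = t • (G *ᵥ ![f.1 0, f.1 1, 1])) :
    S.card ≤ Fintype.card K + 1 := by
  classical
  have hGunit : IsUnit G := (Matrix.isUnit_iff_isUnit_det G).mpr (isUnit_iff_ne_zero.mpr hGdet)
  have hGi : Function.Injective (Matrix.toLin' G) := by
    intro u v h
    simp only [Matrix.toLin'_apply] at h
    exact Matrix.mulVec_injective_iff_isUnit.mpr hGunit h
  set φ := Projectivization.map (Matrix.toLin' G) hGi with hφ_def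
  have hφ : ∀ x y, x ∈ φ y ↔ y ∈ φ x := matrixPolarity_symm K G hG hGi
  -- homogeneous coordinates of the flags
  have hne1 : ∀ a : Fin 2 → K, (![a 0, a 1, (1 : K)] : Fin 3 → K) ≠ 0 := fun a h => by
    simpa using congrFun h 2
  have hne2 : ∀ b : Fin 2 → K, (![b 0, b 1, (-1 : K)] : Fin 3 → K) ≠ 0 := fun b h => by
    simpa using congrFun h 2
  set ι : (Fin 2 → K) × (Fin 2 → K) → ℙ K (Fin 3 → K) × ℙ K (Fin 3 → K) := fun f =>
    (Projectivization.mk K _ (hne1 f.1), Projectivization.mk K _ (hne2 f.2)) with hι_def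
  have hιinj : Set.InjOn ι ↑S := by
    intro f hf f' hf' h
    have h1 := congrArg Prod.fst h
    simp only [hι_def] at h1
    rw [Projectivization.mk_eq_mk_iff'] at h1
    obtain ⟨s, hs⟩ := h1
    have hs2 : s = 1 := by simpa using congrFun hs 2
    have ha : f'.1 = f.1 := by
      funext i
      fin_cases i
      · simpa [hs2] using congrFun hs 0
      · simpa [hs2] using congrFun hs 1
    exact ((hS f' hf' f hf).mp (by rw [ha]; exact (hS f hf f hf).mpr rfl)).symm
  have hflags : ∀ g ∈ S.image ι, g.2 = φ g.1 ∧ g.1 ∈ g.2 := by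
    intro g hg
    obtain ⟨f, hf, rfl⟩ := Finset.mem_image.mp hg
    obtain ⟨t, -, hpol⟩ := hpolar f hf
    refine ⟨?_, ?_⟩
    · simp only [hι_def, hφ_def, Projectivization.map_mk]
      rw [Projectivization.mk_eq_mk_iff']
      exact ⟨t, by rw [Matrix.toLin'_apply]; exact hpol.symm⟩
    · simp only [hι_def, Configuration.ofField.mem_iff, orthogonal_mk]
      have h1 : f.1 ⬝ᵥ f.2 = 1 := (hS f hf f hf).mpr rfl
      simp only [dotProduct, Fin.sum_univ_two] at h1
      simp only [vec3_dotProduct, Matrix.cons_val_zero, Matrix.cons_val_one, Matrix.cons_val]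
      linear_combination h1
  calc S.card = (S.image ι).card := (Finset.card_image_of_injOn hιinj).symm
    _ ≤ Fintype.card K + 1 := card_polar_flags_le_card K hK φ hφ _ hflags

end PG

section Prime

variable (p : ℕ) [hp : Fact p.Prime]

/-- A prime is not a perfect square. [elementary] -/
theorem not_isSquare_prime : ¬ IsSquare p := by
  rintro ⟨m, hm⟩
  have h := hp.out
  rw [hm, Nat.prime_mul_iff] at h
  rcases h with ⟨h, rfl⟩ | ⟨h, rfl⟩ <;> exact Nat.not_prime_one h

/-- **Baer's theorem in the plane of the stub.**  Every polarity of `PG(2,p)`, `p` prime — the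
projective closure of the affine plane over `ZMod p` of `stub_tangencySets` — has exactly `p + 1`
absolute points; so "unital points with their polars as tangents" gives `p + 1` flags there, never
`c·p^{3/2}`. [cite: Baer1946PolaritiesFiniteProjectivePlanes, Thm 6] -/
theorem card_absolute_eq_zmod (φ : ℙ (ZMod p) (Fin 3 → ZMod p) → ℙ (ZMod p) (Fin 3 → ZMod p))
    (hφ : ∀ x y, x ∈ φ y ↔ y ∈ φ x) : Nat.card {x // x ∈ φ x} = p + 1 := by
  have h := card_absolute_eq_card (ZMod p) (by rw [ZMod.card]; exact not_isSquare_prime p) φ hφ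
  rwa [ZMod.card] at h

/-- The conic `x₀² + x₁² + x₂² = 0` of `PG(2,p)` has exactly `p + 1` points, for every prime `p`
(read off Baer's theorem). [elementary] -/
theorem card_isotropic_points_zmod :
    Nat.card {x : ℙ (ZMod p) (Fin 3 → ZMod p) // x ∈ x} = p + 1 := by
  have h := card_isotropic_points (ZMod p) (by rw [ZMod.card]; exact not_isSquare_prime p)
  rwa [ZMod.card] at h

/-- **Polar strong representative systems over `ZMod p` have at most `p + 1` flags** — the
stub's own field: an SRS in the normal form of `stub_tangencySets` whose lines are the polars of
its points under one orthogonal polarity (`(b, −1) ∥ G·(a, 1)`, `G` symmetric, `det G ≠ 0`) has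
`|S| ≤ p + 1 < c·p^{3/2}` for `p > 1/c²`: the "tangent = polar" recipe of the unital is dead in the
stub's plane. [cite: Baer1946PolaritiesFiniteProjectivePlanes, Thm 6 (consequence)] -/
theorem polar_srs_card_le_zmod (G : Matrix (Fin 3) (Fin 3) (ZMod p)) (hG : G.IsSymm)
    (hGdet : G.det ≠ 0) (S : Finset ((Fin 2 → ZMod p) × (Fin 2 → ZMod p)))
    (hS : ∀ f ∈ S, ∀ f' ∈ S, (f.1 ⬝ᵥ f'.2 = 1 ↔ f = f'))
    (hpolar : ∀ f ∈ S, ∃ t : ZMod p, t ≠ 0 ∧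
      (![f.2 0, f.2 1, -1] : Fin 3 → ZMod p) = t • (G *ᵥ ![f.1 0, f.1 1, 1])) :
    S.card ≤ p + 1 := by
  have h := polar_srs_card_le (ZMod p) (by rw [ZMod.card]; exact not_isSquare_prime p) G hG hGdet
    S hS hpolar
  rwa [ZMod.card] at h

end Prime

end Summit.MatrixMultiplication.MatrixMultiplication.Theorems.LevelOneGL2Designs.BaerPolarity
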